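import Summits.CriticalPhenomena.Ising3DConformalLimit.Theses.LogPolarProxy
import Summits.CriticalPhenomena.Ising3DConformalLimit.Theorems.LogPolarProxyProxyUniversalitySymmetries

/-!
# `LogPolarProxy.ProxyReflectionSymmetry` (stmt-CriticalPhenomena-11290) — proved

Route `route-CriticalPhenomena-LogPolarProxy`, sub-problem `Ising3DConformalLimit`, support item #9
`ProxyReflectionSymmetry`: for all row-wise nearest-neighbour profiles `J_r, J_θ, J_φ`, all resolutions `N`,
all orders `n` and all index configurations `v`, the free-b.c. finite Gibbs average of the spin monomial of
the log-polar proxy at the RADIALLY MIRRORED configuration (`Fin.rev` on the radial index, polar and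
azimuthal indices fixed) equals that at `v`.

Proof: the route decl is, definitionally, the statement `gibbsAvg_radialMirror` of the landed symmetry
module `LogPolarProxyProxyUniversalitySymmetries` (p155813, lead c1 of crux stmt-CriticalPhenomena-11288):
the inlined pair coupling of the decl is `coupling Jr Jt Jp N` and the inlined Boltzmann factor is
`gibbsWeight Jr Jt Jp N` of `LogPolarProxyProxyUniversalityDefs` (both `def`s copied verbatim from the route
file), and the radial mirror `Equiv.prodCongr Fin.revPerm (Equiv.refl _)` is a coupling-preserving bijection
of the finite index set, under which the finite Gibbs average is invariant by reindexing both sums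
(`gibbsAvg_comp_perm`). This is the exact graph symmetry `i ↦ 2M − i` of the proxy, i.e. the unit inversion
`x ↦ x/‖x‖²` in the log-radial coordinate (Brower–Fleming–Neuberger 2013, p.4: "r = e^t turns … inversion
into a parity in t").

Sources: R. C. Brower, G. T. Fleming, H. Neuberger, *Lattice radial quantization: 3D Ising*, Phys. Lett.
B 721 (2013) 299–305 [BrowerFlemingNeuberger2013]; S. Friedli, Y. Velenik, *Statistical Mechanics of
Lattice Systems* (CUP 2017), §3 (finite-volume Gibbs averages) [FriedliVelenik2017].
-/

namespace Summit.CriticalPhenomena.Ising3DConformalLimit.LogPolarProxyProxyReflectionSymmetry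

open Summit.CriticalPhenomena.Ising3DConformalLimit.Theses.LogPolarProxy (ProxyReflectionSymmetry)
open Summit.CriticalPhenomena.Ising3DConformalLimit.Cruxes.ProxyUniversality.Birth (gibbsAvg_radialMirror)

/-- **`ProxyReflectionSymmetry` holds** (item stmt-CriticalPhenomena-11290): the finite Gibbs average of
the log-polar proxy is invariant under the radial mirror `Fin.rev × id × id` of the index configuration,
for every profile, resolution and order — the named reindexing theorem `gibbsAvg_radialMirror`, whose
statement is the route decl unfolded (`coupling`, `gibbsWeight` are definitionally the inlined terms). -/
theorem proxyReflectionSymmetry_proof : ProxyReflectionSymmetry :=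
  fun Jr Jt Jp N n v => gibbsAvg_radialMirror Jr Jt Jp N n v

end Summit.CriticalPhenomena.Ising3DConformalLimit.LogPolarProxyProxyReflectionSymmetry
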